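import Literature.NumberTheory.PAdicHodge.TateAlmostEtalePTower
import HarnessLib

/-!
# The almost-perfectoid package ascends along `p`-chains of a Galois group
# (Tate's almost étale lemma, Tate 1967 §3.2 Prop. 9 / Berger–Colmez (TS1) — dévissage, part D′1)

Notation of `TateAlmostEtalePTower` (`K₀ ⊆ K_∞ ⊆ B ⊆ F̄`, `q = ‖p‖`, package `pkg_s` = (Γ) + (U_s)).
Main result:

* `TateAlmostEtale.pChain_package` : for a finite Galois extension `B ⊆ L ⊆ F̄` with `K_∞ ⊆ B` and
  subgroups `Q' ≤ Q` of `Gal(L/B)` with `Q` a `p`-group: **`pkg(L^Q) ⇒ pkg(L^{Q'})`** (fixed fields,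
  lifted into `F̄`). Proof: by Sylow's theorem inside `Q` (`Sylow.exists_subgroup_card_pow_succ`) there is
  `Q' ≤ Q'' ≤ Q` with `[Q'' : Q'] = p`, and `Q' ◁ Q''` (index `p` = least prime factor,
  `Subgroup.normal_of_index_eq_minFac_card`); by induction `pkg(L^{Q''})`; then `L^{Q'}/L^{Q''}` is Galois
  of degree `p`, hence Kummer (`μ_p ⊆ K_∞ ⊆ B`, Mathlib `exists_root_adjoin_eq_top_of_isCyclic`), and
  `TateAlmostEtale.adjoin_exists_norm_pow_eq` / `adjoin_exists_norm_sub_pow_le` propagate the package.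

With the `p`-primary dévissage (`pGalois_package_and_trace`) and the bridge
(`tate1967_TS1_of_almostEtale_fin`) this leaves, for the Tate–Sen axiom (TS1), only the package of the
prime-to-`p` bottom field `L^P` (`P` Sylow) and the final Sylow assembly. No `sorry`, no definitions;
BSD is not proved by any of this. References: [Tate1967] §3.2 Prop. 9; [BergerColmez2008] Prop. 4.1.1.
-/

noncomputable section

open Polynomial IntermediateField Module ValuativeRel Field

namespace Literature.NumberTheory.PAdicHodge

namespace TateAlmostEtale

open Literature.NumberTheory.GaloisRepresentations
open Literature.NumberTheory.GaloisRepresentations.IsNonarchimedeanLocalField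

variable {F : Type} [Field F] [ValuativeRel F] [TopologicalSpace F] [IsNonarchimedeanLocalField F]
  [CharZero F] {p : ℕ} [Fact p.Prime] (hp : valuation F p < 1)

/-! ### Group theory: an intermediate subgroup of index `p` above a proper subgroup of a `p`-group -/

/-- In a finite `p`-group `Q ≤ G`, a subgroup `Q' ≤ Q` with `|Q| = p^{n+1} |Q'|` sits with index `p` and
normally in some `Q'' ≤ Q` with `|Q| = p^n |Q''|`. [folklore] -/
private theorem exists_intermediate_index_prime {G : Type*} [Group G] [Finite G]
    {Q Q' : Subgroup G} (hle : Q' ≤ Q) (hQ : IsPGroup p Q) {n : ℕ}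
    (hcard : Nat.card Q = p ^ (n + 1) * Nat.card Q') :
    ∃ Q'' : Subgroup G, Q' ≤ Q'' ∧ Q'' ≤ Q ∧ Nat.card Q = p ^ n * Nat.card Q'' ∧
      Nat.card Q'' = p * Nat.card Q' ∧ (Q'.subgroupOf Q'').Normal := by
  have hprime : p.Prime := Fact.out
  obtain ⟨b, hb⟩ := IsPGroup.iff_card.mp (hQ.to_le hle)
  set H : Subgroup Q := Q'.subgroupOf Q with hH
  have hHcard : Nat.card H = p ^ b := by
    rw [hH, ← hb]; exact Nat.card_congr (Subgroup.subgroupOfEquivOfLe hle).toEquiv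
  have hdvd : p ^ (b + 1) ∣ Nat.card Q := by
    rw [hcard, hb, pow_succ, pow_succ]
    exact ⟨p ^ n, by ring⟩
  obtain ⟨K, hKcard, hHK⟩ := Sylow.exists_subgroup_card_pow_succ hdvd hHcard
  set Q'' : Subgroup G := K.map Q.subtype with hQ''
  have hQ''card : Nat.card Q'' = p ^ (b + 1) := by
    rw [hQ'', Subgroup.card_map_of_injective Subtype.val_injective, hKcard]
  have hQ'le : Q' ≤ Q'' := by
    intro x hx
    exact ⟨⟨x, hle hx⟩, hHK (by simpa [hH, Subgroup.mem_subgroupOf] using hx), rfl⟩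
  have hQ''le : Q'' ≤ Q := by
    rintro _ ⟨y, -, rfl⟩; exact y.2
  refine ⟨Q'', hQ'le, hQ''le, ?_, ?_, ?_⟩
  · have : Nat.card Q = p ^ n * p ^ (b + 1) := by rw [hcard, hb]; ring
    rw [this, hQ''card]
  · rw [hQ''card, hb, pow_succ, mul_comm]
  · apply Subgroup.normal_of_index_eq_minFac_card
    have hsub : Nat.card (Q'.subgroupOf Q'') = p ^ b := by
      rw [← hb]; exact Nat.card_congr (Subgroup.subgroupOfEquivOfLe hQ'le).toEquiv
    have hidx := Subgroup.card_mul_index (Q'.subgroupOf Q'')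
    rw [hsub, hQ''card, pow_succ] at hidx
    have hidx' : (Q'.subgroupOf Q'').index = p :=
      Nat.eq_of_mul_eq_mul_left (pow_pos hprime.pos b) hidx
    rw [hidx', hQ''card, hprime.pow_minFac (Nat.succ_ne_zero b)]

/-! ### The induction along the chain -/

set_option synthInstance.maxHeartbeats 200000 in
set_option maxHeartbeats 1600000 in
/-- The statement proved by induction on `n` (`|Q| = p^n |Q'|`): the package ascends from `L^Q` to
`L^{Q'}` (spelled out; public form `pChain_package`). Nested subtypes `B ⊆ L^{Q''} ⊆ L ⊆ F̄`, whence the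
raised instance-search budget. [folklore] -/
private theorem pChain_package_aux (n : ℕ) :
    ∀ (B : IntermediateField (PadicBase F p hp) (NormedAlgClosure F)), TateTrace.Kinf hp ≤ B →
    ∀ (L : IntermediateField B (NormedAlgClosure F)) [FiniteDimensional B L] [IsGalois B L]
      (Q Q' : Subgroup (L ≃ₐ[B] L)), Q' ≤ Q → IsPGroup p Q → Nat.card Q = p ^ n * Nat.card Q' →
    ∀ (s : ℝ), 0 < s →
    (∀ x ∈ IntermediateField.lift (IntermediateField.fixedField Q), x ≠ 0 →
      ∃ c ∈ IntermediateField.lift (IntermediateField.fixedField Q), ‖c‖ ^ p = ‖x‖) →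
    (∀ u ∈ IntermediateField.lift (IntermediateField.fixedField Q), ‖u‖ ≤ 1 →
      ∃ w ∈ IntermediateField.lift (IntermediateField.fixedField Q),
        ‖u - w ^ p‖ ≤ ‖(p : NormedAlgClosure F)‖ ^ s) →
    ∃ s' : ℝ, 0 < s' ∧
      (∀ x ∈ IntermediateField.lift (IntermediateField.fixedField Q'), x ≠ 0 →
        ∃ c ∈ IntermediateField.lift (IntermediateField.fixedField Q'), ‖c‖ ^ p = ‖x‖) ∧
      (∀ u ∈ IntermediateField.lift (IntermediateField.fixedField Q'), ‖u‖ ≤ 1 →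
        ∃ w ∈ IntermediateField.lift (IntermediateField.fixedField Q'),
          ‖u - w ^ p‖ ≤ ‖(p : NormedAlgClosure F)‖ ^ s') := by
  have hprime : p.Prime := Fact.out
  have hp0 : (p : NormedAlgClosure F) ≠ 0 := Nat.cast_ne_zero.mpr hprime.ne_zero
  have hq1 : ‖(p : NormedAlgClosure F)‖ < 1 := by
    rw [PadicBase.norm_natCast_closure hp]; exact PadicBase.norm_p_lt_one hp
  induction n with
  | zero =>
    intro B hKB L _ _ Q Q' hle hQ hcard s hs hΓ hU
    rw [pow_zero, one_mul] at hcard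
    have hQQ' : Q' = Q := Subgroup.eq_of_le_of_card_ge hle hcard.le
    subst hQQ'
    exact ⟨s, hs, hΓ, hU⟩
  | succ n IH =>
    intro B hKB L _ _ Q Q' hle hQ hcard s hs hΓ hU
    classical
    -- `Q' ◁ Q'' ≤ Q` with `[Q'' : Q'] = p`; induction hypothesis for `Q''`
    obtain ⟨Q'', hQ'Q'', hQ''Q, hcardQ, hcardQ'', hnorm⟩ :=
      exists_intermediate_index_prime (p := p) hle hQ hcard
    obtain ⟨s₁, hs₁, hΓ₁, hU₁⟩ := IH B hKB L Q Q'' hQ''Q hQ hcardQ s hs hΓ hU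
    haveI := hnorm
    -- the base `B₁ = L^{Q''}` and its Galois group `G₁ ≅ Q''`
    set B₁ : IntermediateField B L := IntermediateField.fixedField Q'' with hB₁
    haveI : Module.Free B₁ L := Module.Free.of_divisionRing B₁ L
    haveI : IsGalois B₁ L := IsGalois.tower_top_of_isGalois B B₁ L
    let eQ : Q'' ≃* (L ≃ₐ[B₁] L) := IntermediateField.subgroupEquivAlgEquiv Q''
    have heQ : ∀ (q : Q'') (x : L), eQ q x = (q : L ≃ₐ[B] L) x := fun q x => rfl
    set N : Subgroup (L ≃ₐ[B₁] L) := (Q'.subgroupOf Q'').map eQ.toMonoidHom with hN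
    haveI hNn : N.Normal := Subgroup.Normal.map hnorm eQ.toMonoidHom eQ.surjective
    have hNcard : Nat.card N = Nat.card Q' := by
      rw [hN, Subgroup.card_map_of_injective eQ.injective]
      exact Nat.card_congr (Subgroup.subgroupOfEquivOfLe hQ'Q'').toEquiv
    have hG₁card : Nat.card (L ≃ₐ[B₁] L) = Nat.card Q'' := (Nat.card_congr eQ.toEquiv).symm
    -- `F₁ = L^N = L^{Q'}`: Galois over `B₁` of degree `p`
    set F₁ : IntermediateField B₁ L := IntermediateField.fixedField N with hF₁
    haveI : Module.Free B₁ F₁ := Module.Free.of_divisionRing B₁ F₁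
    haveI : Module.Free F₁ L := Module.Free.of_divisionRing F₁ L
    have hmemF₁ : ∀ x : L, x ∈ F₁ ↔ x ∈ IntermediateField.fixedField Q' := by
      intro x
      rw [hF₁, IntermediateField.mem_fixedField_iff, IntermediateField.mem_fixedField_iff]
      constructor
      · intro h q hq
        have hq'' : q ∈ Q'' := hQ'Q'' hq
        have hmem : eQ ⟨q, hq''⟩ ∈ N := by
          rw [hN]; exact ⟨⟨q, hq''⟩, by simpa [Subgroup.mem_subgroupOf] using hq, rfl⟩
        have := h _ hmem
        rwa [heQ] at this
      · rintro h f ⟨q, hq, rfl⟩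
        have hq' : (q : L ≃ₐ[B] L) ∈ Q' := by
          simpa only [SetLike.mem_coe, Subgroup.mem_subgroupOf] using hq
        change eQ q x = x
        rw [heQ]; exact h _ hq'
    have hfinF₁L : finrank F₁ L = Nat.card Q' := by
      rw [hF₁, IntermediateField.finrank_fixedField_eq_card, hNcard]
    have hfinB₁L : finrank B₁ L = Nat.card Q'' := by
      rw [hB₁, IntermediateField.finrank_fixedField_eq_card]
    have hQ'pos : 0 < Nat.card Q' := Nat.card_pos
    have hfin₁ : finrank B₁ F₁ = p := by
      have h := Module.finrank_mul_finrank B₁ F₁ L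
      rw [hfinF₁L, hfinB₁L, hcardQ''] at h
      exact Nat.eq_of_mul_eq_mul_right hQ'pos h
    haveI : IsGalois B₁ F₁ := IsGalois.of_fixedField_normal_subgroup N
    haveI : IsCyclic (F₁ ≃ₐ[B₁] F₁) := by
      apply isCyclic_of_prime_card (p := p)
      rw [IsGalois.card_aut_eq_finrank, hfin₁]
    -- Kummer generation of `F₁/B₁`
    have hζB : CyclotomicTower.zeta F p 1 ∈ B := hKB (zeta_one_mem_Kinf hp)
    have hζL : algebraMap B (NormedAlgClosure F) ⟨_, hζB⟩ ∈ L := IntermediateField.algebraMap_mem L _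
    set ζL : L := ⟨CyclotomicTower.zeta F p 1, hζL⟩ with hζLdef
    have hζB₁ : ζL ∈ B₁ := by
      rw [hB₁, IntermediateField.mem_fixedField_iff]
      intro g _
      have : ζL = algebraMap B L ⟨_, hζB⟩ := Subtype.ext rfl
      rw [this, AlgEquiv.commutes]
    have hprim : (primitiveRoots (finrank B₁ F₁) B₁).Nonempty := by
      rw [hfin₁]
      refine ⟨⟨ζL, hζB₁⟩, ?_⟩
      rw [mem_primitiveRoots hprime.pos]
      have hinj : Function.Injective ((algebraMap L (NormedAlgClosure F)).comp (algebraMap B₁ L)) :=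
        (algebraMap L (NormedAlgClosure F)).injective.comp (algebraMap B₁ L).injective
      refine IsPrimitiveRoot.of_map_of_injective (f := (algebraMap L (NormedAlgClosure F)).comp
        (algebraMap B₁ L)) ?_ hinj
      have h1 := CyclotomicTower.zeta_spec F p 1
      rw [pow_one] at h1
      exact h1
    obtain ⟨α, ⟨a₁, ha₁⟩, hgen⟩ := exists_root_adjoin_eq_top_of_isCyclic B₁ F₁ hprim
    rw [hfin₁] at ha₁
    have hirr₁ : Irreducible (X ^ p - C a₁) := by
      have h := irreducible_X_pow_sub_C_of_root_adjoin_eq_top (K := B₁) (L := F₁) (a := a₁) (α := α)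
        (by rw [hfin₁]; exact ha₁.symm) hgen
      rwa [hfin₁] at h
    -- transport to the base `M₁ = lift B₁` over `K₀`
    set B₁e : IntermediateField B (NormedAlgClosure F) := IntermediateField.lift B₁ with hB₁e
    let e₁ : B₁ ≃ₐ[B] B₁e := IntermediateField.liftAlgEquiv B₁
    have he₁ : ∀ z : B₁, ((e₁ z : B₁e) : NormedAlgClosure F) = ((z : L) : NormedAlgClosure F) :=
      fun z => IntermediateField.liftAlgEquiv_apply B₁ z
    set M₁ : IntermediateField (PadicBase F p hp) (NormedAlgClosure F) :=
      B₁e.restrictScalars (PadicBase F p hp) with hM₁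
    have hmemM₁ : ∀ x : NormedAlgClosure F, x ∈ M₁ ↔ x ∈ B₁e := fun x =>
      IntermediateField.mem_restrictScalars (PadicBase F p hp)
    have hΓM₁ : ∀ x ∈ M₁, x ≠ 0 → ∃ c ∈ M₁, ‖c‖ ^ p = ‖x‖ := by
      intro x hx hx0
      obtain ⟨c, hc, h⟩ := hΓ₁ x ((hmemM₁ x).mp hx) hx0
      exact ⟨c, (hmemM₁ c).mpr hc, h⟩
    have hUM₁ : ∀ u ∈ M₁, ‖u‖ ≤ 1 → ∃ w ∈ M₁, ‖u - w ^ p‖ ≤ ‖(p : NormedAlgClosure F)‖ ^ s₁ := by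
      intro u hu hu1
      obtain ⟨w, hw, h⟩ := hU₁ u ((hmemM₁ u).mp hu) hu1
      exact ⟨w, (hmemM₁ w).mpr hw, h⟩
    let eM : B₁ ≃+* M₁ := e₁.toRingEquiv
    have heM : ∀ z : B₁, ((eM z : M₁) : NormedAlgClosure F) = ((z : L) : NormedAlgClosure F) := he₁
    set a' : M₁ := eM a₁ with ha'
    have hirr' : Irreducible (X ^ p - C a') := by
      have h : Polynomial.mapEquiv eM (X ^ p - C a₁) = X ^ p - C a' := by
        rw [mapEquiv_apply, Polynomial.map_sub, Polynomial.map_pow, map_X, map_C]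
        rfl
      rw [← h, MulEquiv.irreducible_iff]
      exact hirr₁
    set αE : NormedAlgClosure F := (((α : F₁) : L) : NormedAlgClosure F) with hαE
    have hαE' : αE ^ p = (a' : NormedAlgClosure F) := by
      rw [ha', heM]
      change αE ^ p = (((algebraMap B₁ F₁ a₁ : F₁) : L) : NormedAlgClosure F)
      rw [ha₁, hαE]
      push_cast
      rfl
    -- the package of `M₁(α)` by the Kummer step
    set s' : ℝ := min s₁ 1 / 2 with hs'
    have hs'0 : 0 < s' := by rw [hs']; positivity
    have hs'1 : s' < min s₁ 1 := by
      rw [hs']; linarith [lt_min hs₁ one_pos]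
    have hΓ' : ∀ {x : NormedAlgClosure F}, x ∈ (↥M₁)⟮αE⟯ → x ≠ 0 →
        ∃ c ∈ (↥M₁)⟮αE⟯, ‖c‖ ^ p = ‖x‖ :=
      fun hx hx0 => adjoin_exists_norm_pow_eq hp M₁ hΓM₁ hirr' hαE' hx hx0
    have hU' : ∀ {u : NormedAlgClosure F}, u ∈ (↥M₁)⟮αE⟯ → ‖u‖ ≤ 1 →
        ∃ w ∈ (↥M₁)⟮αE⟯, ‖u - w ^ p‖ ≤ ‖(p : NormedAlgClosure F)‖ ^ s' :=
      fun hu hu1 => adjoin_exists_norm_sub_pow_le hp M₁ hs₁ hΓM₁ hUM₁ hirr' hαE' hs'0 hs'1 hu hu1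
    -- `M₁(α) = lift (L^{Q'})` as sets
    set T : IntermediateField B (NormedAlgClosure F) :=
      IntermediateField.lift (IntermediateField.fixedField Q') with hT
    have hmemT : ∀ x : NormedAlgClosure F, x ∈ T ↔ ∃ hx : x ∈ L, (⟨x, hx⟩ : L) ∈ F₁ := by
      intro x
      constructor
      · intro hx
        have hxL : x ∈ L := IntermediateField.lift_le _ hx
        refine ⟨hxL, (hmemF₁ _).mpr ?_⟩
        exact (IntermediateField.mem_lift (⟨x, hxL⟩ : L)).mp hx
      · rintro ⟨hxL, hxF⟩
        exact (IntermediateField.mem_lift (⟨x, hxL⟩ : L)).mpr ((hmemF₁ _).mp hxF)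
    have hM₁T : M₁ ≤ T.restrictScalars (PadicBase F p hp) := by
      intro x hx
      rw [IntermediateField.mem_restrictScalars, hmemT]
      have hxB₁e : x ∈ B₁e := (hmemM₁ x).mp hx
      have hxL : x ∈ L := IntermediateField.lift_le _ hxB₁e
      refine ⟨hxL, ?_⟩
      have hxB₁ : (⟨x, hxL⟩ : L) ∈ B₁ := (IntermediateField.mem_lift (⟨x, hxL⟩ : L)).mp hxB₁e
      exact (IntermediateField.algebraMap_mem F₁ ⟨_, hxB₁⟩ : _)
    set Lext : IntermediateField M₁ (NormedAlgClosure F) := IntermediateField.extendScalars hM₁T with hLext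
    have hmemLext : ∀ x : NormedAlgClosure F, x ∈ Lext ↔ x ∈ T := fun x => Iff.rfl
    let j : F₁ ≃+* Lext :=
      { toFun := fun x => ⟨((x : L) : NormedAlgClosure F), (hmemLext _).mpr ((hmemT _).mpr ⟨(x : L).2, x.2⟩)⟩
        invFun := fun x => ⟨⟨x.1, IntermediateField.lift_le _ ((hmemLext _).mp x.2)⟩,
            ((hmemT x.1).mp ((hmemLext _).mp x.2)).2⟩
        left_inv := fun x => rfl
        right_inv := fun x => rfl
        map_mul' := fun x y => rfl
        map_add' := fun x y => rfl }
    have hcompat : (algebraMap M₁ Lext).comp eM.toRingHom = j.toRingHom.comp (algebraMap B₁ F₁) := by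
      ext z
      exact heM z
    have hfinLext : finrank M₁ Lext = p := by
      rw [← Algebra.finrank_eq_of_equiv_equiv eM j hcompat, hfin₁]
    haveI : FiniteDimensional M₁ Lext := Module.finite_of_finrank_pos (by rw [hfinLext]; exact hprime.pos)
    have hintα : IsIntegral M₁ αE :=
      ⟨X ^ p - C a', monic_X_pow_sub_C a' hprime.ne_zero, by simp [hαE']⟩
    have hfinadj : finrank M₁ (↥M₁)⟮αE⟯ = p := by
      have hmin : minpoly M₁ αE = X ^ p - C a' :=
        (minpoly.eq_of_irreducible_of_monic hirr' (by simp [hαE']) (monic_X_pow_sub_C a' hprime.ne_zero)).symm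
      rw [adjoin.finrank hintα, hmin, natDegree_X_pow_sub_C]
    have hadjle : (↥M₁)⟮αE⟯ ≤ Lext := by
      rw [adjoin_simple_le_iff, hmemLext, hmemT]
      exact ⟨((α : F₁) : L).2, α.2⟩
    have hadjeq : (↥M₁)⟮αE⟯ = Lext :=
      IntermediateField.eq_of_le_of_finrank_eq hadjle (by rw [hfinadj, hfinLext])
    have hmemadj : ∀ x : NormedAlgClosure F, x ∈ (↥M₁)⟮αE⟯ ↔ x ∈ T := fun x => by
      rw [hadjeq]; exact hmemLext x
    refine ⟨s', hs'0, fun x hx hx0 => ?_, fun u hu hu1 => ?_⟩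
    · obtain ⟨c, hc, h⟩ := hΓ' ((hmemadj x).mpr hx) hx0
      exact ⟨c, (hmemadj c).mp hc, h⟩
    · obtain ⟨w, hw, h⟩ := hU' ((hmemadj u).mpr hu) hu1
      exact ⟨w, (hmemadj w).mp hw, h⟩

/-- **The package ascends along `p`-chains** (dévissage D′1 of Tate's almost étale lemma): for
`K_∞ ⊆ B`, `B ⊆ L ⊆ F̄` finite Galois, and subgroups `Q' ≤ Q ≤ Gal(L/B)` with `Q` a `p`-group, the
almost-perfectoid package of (the lift to `F̄` of) `L^Q` implies that of `L^{Q'}`.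
[cite: Tate1967, §3.2 Prop. 9] [cite: BergerColmez2008, Prop. 4.1.1] -/
theorem pChain_package (B : IntermediateField (PadicBase F p hp) (NormedAlgClosure F))
    (hKB : TateTrace.Kinf hp ≤ B) (L : IntermediateField B (NormedAlgClosure F))
    [FiniteDimensional B L] [IsGalois B L] (Q Q' : Subgroup (L ≃ₐ[B] L)) (hle : Q' ≤ Q)
    (hQ : IsPGroup p Q) {s : ℝ} (hs : 0 < s)
    (hΓ : ∀ x ∈ IntermediateField.lift (IntermediateField.fixedField Q), x ≠ 0 →
      ∃ c ∈ IntermediateField.lift (IntermediateField.fixedField Q), ‖c‖ ^ p = ‖x‖)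
    (hU : ∀ u ∈ IntermediateField.lift (IntermediateField.fixedField Q), ‖u‖ ≤ 1 →
      ∃ w ∈ IntermediateField.lift (IntermediateField.fixedField Q),
        ‖u - w ^ p‖ ≤ ‖(p : NormedAlgClosure F)‖ ^ s) :
    ∃ s' : ℝ, 0 < s' ∧
      (∀ x ∈ IntermediateField.lift (IntermediateField.fixedField Q'), x ≠ 0 →
        ∃ c ∈ IntermediateField.lift (IntermediateField.fixedField Q'), ‖c‖ ^ p = ‖x‖) ∧
      (∀ u ∈ IntermediateField.lift (IntermediateField.fixedField Q'), ‖u‖ ≤ 1 →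
        ∃ w ∈ IntermediateField.lift (IntermediateField.fixedField Q'),
          ‖u - w ^ p‖ ≤ ‖(p : NormedAlgClosure F)‖ ^ s') := by
  have hprime : p.Prime := Fact.out
  -- `|Q| = p^n |Q'|` for some `n`
  obtain ⟨a, ha⟩ := IsPGroup.iff_card.mp hQ
  obtain ⟨b, hb⟩ := IsPGroup.iff_card.mp (hQ.to_le hle)
  have hdvd : Nat.card Q' ∣ Nat.card Q := Subgroup.card_dvd_of_le hle
  rw [ha, hb, Nat.pow_dvd_pow_iff_le_right hprime.one_lt] at hdvd
  have hcard : Nat.card Q = p ^ (a - b) * Nat.card Q' := by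
    rw [ha, hb, ← pow_add, Nat.sub_add_cancel hdvd]
  exact pChain_package_aux hp (a - b) B hKB L Q Q' hle hQ hcard s hs hΓ hU

end TateAlmostEtale

end Literature.NumberTheory.PAdicHodge

end
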